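import Summits.ValiantsHypothesis.ValiantsHypothesis.Theses.BarrierLever
import Summits.ValiantsHypothesis.ValiantsHypothesis.Theorems.BarrierLeverPartitionMinorsHitByVPStubJoinDoorWide
import Summits.ValiantsHypothesis.ValiantsHypothesis.Theorems.BarrierLeverPartitionMinorsHitByVPOfLowerSetsDoors
import Summits.ValiantsHypothesis.ValiantsHypothesis.Theorems.BarrierLeverPartitionMinorsHitByVPHiddenStatesAFit

/-!
# Route BarrierLever — item `PartitionMinorsHitByVP` (stmt-ValiantsHypothesis-19717), line `hidden_states`:
# the conjecture node RESTRICTED TO LOWER SETS, and the PAIR node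

Link file (`--supports stmt-ValiantsHypothesis-19717`; cell valiant-natproofs, rung V4, 𝒟-side door (c); prover seat
val-np-p6 gen 9). Three typed statements (conjectures, NOT asserted) and their kernel-checked compositions with the crux.
Closes NO item.

WHY. The registered stubs of the line (`Stmt.stub_universalJoinWide`, `Stmt.stub_fit`, `Stmt.stub_afit` in
`Cruxes/PartitionMinorsHitByVP/Lines/hidden_states.lean`) ask ONE legal wide join threshold family per `(h, r)` to be good
(resp. `Fit`- / `AFit`-certified) against EVERY injective row family `u`. The conjectures actually studied by the cell
(F⁺-PEEL, AF⁺, the weighted BALL game; memos HOME/val-np-p3/g10, HOME/val-np-p6/g8) and every census are stated and run for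
DOWN-SETS `u` (simplicial complexes), whose tries are nested (`link ⊆ deletion` at every node) — the structure an inductive
proof would use. By val-np-p1 g12's landed LOWER-SET REDUCTION (`DownCompression.partitionMinorsHitByVP_of_lowerSets`,
`…PartitionMinorsHitByVPOfLowerSetsDoors.lean`) the crux only needs layouts whose row AND column families are lower sets, so the
node may be weakened accordingly, at the price `b = 8 ↦ b = 12`:

* `Stmt.universalJoinWideLower` — ONE legal wide design per `(h, r)`, good for every injective `u` with `IsLowerSet (Set.range u)`;
* `Stmt.afitLower` — the same with `SymbJoin.AFit`-certificates (val-np-p6 g8's combinatorial cut trees, p593109);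
* `Stmt.pairJoinWideLower` — the WEAKEST node this door admits: for every PAIR `(u, w)` of lower-set injective families of the
  same size, SOME legal wide design good for both (the design may depend on the pair).

Implications (all proved here): `SymbJoin.Stmt.afitConjecture → afitLower → universalJoinWideLower → pairJoinWideLower →
Theses.BarrierLever.PartitionMinorsHitByVP`, and `SymbJoin.Stmt.universalJoinWide → universalJoinWideLower`.

CENSUS NOTE (this seat, HOME/val-np-p6/g9/kit/nondown*.py): the full-peel design of record is GOOD (exact rank) and
ball-game certified on every NON-down-set family tested at h ≤ 9 (parity classes, single layers, layer unions, up-sets,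
random injective families, antichains: 0 failures / ≈ 330 instances) — so the restriction is offered as the form matching the
conjectures' statements and proofs-to-be, not because non-down-sets are known to be harder.

WHAT THIS IS NOT: no proof of any of the three statements; item 19717 stays OPEN; nothing on crux 14610 or on VP ≠ VNP.
-/

set_option linter.dupNamespace false

namespace Summit.ValiantsHypothesis.ValiantsHypothesis.Theorems.BarrierLever.HiddenStates

open Finset Matrix MvPolynomial
open Literature.Barriers.ValiantsHypothesis (SmallCircuits)

noncomputable section

namespace LowerNode

/-! ## The three typed statements -/

/-- **The conjecture node restricted to lower sets (typed; not asserted).** For all large `h` and every `r ≤ 2^h` there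
is ONE legal wide join threshold family (`m ≤ 2h` pieces, `K ≤ h³` states, joint strict threshold) whose block-additive
matrix is nonsingular at some table for EVERY injective row family `u` whose range is a LOWER SET. -/
def Stmt.universalJoinWideLower : Prop :=
  ∃ h₁ : ℕ, ∀ h : ℕ, h₁ ≤ h → ∀ r : ℕ, r ≤ 2 ^ h →
    ∃ (m K : ℕ) (W : Fin m → ℕ) (wt : Fin m → Fin K → ℕ) (e : Fin r → Fin m × Finset (Fin K)),
      m ≤ h + h ∧ K ≤ h * h * h ∧ Function.Injective e ∧
      (∀ x : Fin m × Finset (Fin K), x ∉ Set.range e →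
        ∀ i, W (e i).1 + ∑ k ∈ (e i).2, wt (e i).1 k < W x.1 + ∑ k ∈ x.2, wt x.1 k) ∧
      ∀ u : Fin r → Finset (Fin h), Function.Injective u → IsLowerSet (Set.range u) →
        ∃ tx : Fin m → Option (Fin K) → Fin h → ℂ,
          (Matrix.of fun i k : Fin r =>
            ∏ a ∈ u i, (tx (e k).1 none a + ∑ q ∈ (e k).2, tx (e k).1 (some q) a)).det ≠ 0

/-- **The combinatorial fitting conjecture restricted to lower sets (typed; not asserted).** As `SymbJoin.Stmt.afitConjecture`
(p593109) but the `AFit`-certificate is required only against injective row families whose range is a lower set. -/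
def Stmt.afitLower : Prop :=
  ∃ h₁ : ℕ, ∀ h : ℕ, h₁ ≤ h → ∀ r : ℕ, r ≤ 2 ^ h →
    ∃ (m K : ℕ) (W : Fin m → ℕ) (wt : Fin m → Fin K → ℕ) (e : Fin r → Fin m × Finset (Fin K)),
      m ≤ h + h ∧ K ≤ h * h * h ∧ Function.Injective e ∧
      (∀ x : Fin m × Finset (Fin K), x ∉ Set.range e →
        ∀ i, W (e i).1 + ∑ k ∈ (e i).2, wt (e i).1 k < W x.1 + ∑ k ∈ x.2, wt x.1 k) ∧
      ∀ u : Fin r → Finset (Fin h), Function.Injective u → IsLowerSet (Set.range u) → SymbJoin.AFit u e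

/-- **The pair node restricted to lower sets (typed; not asserted)** — the weakest hypothesis the wide join door accepts:
for all large `h` and every PAIR `(u, w)` of injective families of `r` subsets of `Fin h` with lower-set ranges there is a
legal wide join threshold family (possibly depending on the pair) whose block-additive matrix is nonsingular at some table
for `u` and at some table for `w`. -/
def Stmt.pairJoinWideLower : Prop :=
  ∃ h₁ : ℕ, ∀ h : ℕ, h₁ ≤ h → ∀ (r : ℕ) (u w : Fin r → Finset (Fin h)),
    Function.Injective u → Function.Injective w → IsLowerSet (Set.range u) → IsLowerSet (Set.range w) →
    ∃ (m K : ℕ) (W : Fin m → ℕ) (wt : Fin m → Fin K → ℕ) (e : Fin r → Fin m × Finset (Fin K)),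
      m ≤ h + h ∧ K ≤ h * h * h ∧ Function.Injective e ∧
      (∀ x : Fin m × Finset (Fin K), x ∉ Set.range e →
        ∀ i, W (e i).1 + ∑ k ∈ (e i).2, wt (e i).1 k < W x.1 + ∑ k ∈ x.2, wt x.1 k) ∧
      (∃ tx : Fin m → Option (Fin K) → Fin h → ℂ,
        (Matrix.of fun i k : Fin r =>
          ∏ a ∈ u i, (tx (e k).1 none a + ∑ q ∈ (e k).2, tx (e k).1 (some q) a)).det ≠ 0) ∧
      (∃ ty : Fin m → Option (Fin K) → Fin h → ℂ,
        (Matrix.of fun j k : Fin r =>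
          ∏ c ∈ w j, (ty (e k).1 none c + ∑ q ∈ (e k).2, ty (e k).1 (some q) c)).det ≠ 0)

/-! ## Implications between the statements -/

/-- The unrestricted node (`SymbJoin.Stmt.universalJoinWide`, body of the line's `Stmt.stub_universalJoinWide`) implies the
lower-set node. -/
theorem universalJoinWideLower_of_universalJoinWide (H : SymbJoin.Stmt.universalJoinWide) :
    Stmt.universalJoinWideLower := by
  obtain ⟨h₁, H⟩ := H
  refine ⟨h₁, fun h hh r hr => ?_⟩
  obtain ⟨m, K, W, wt, e, hm, hK, he, hthr, Hu⟩ := H h hh r hr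
  exact ⟨m, K, W, wt, e, hm, hK, he, hthr, fun u hu _ => Hu u hu⟩

/-- The unrestricted combinatorial fitting conjecture implies the lower-set one. -/
theorem afitLower_of_afitConjecture (H : SymbJoin.Stmt.afitConjecture) : Stmt.afitLower := by
  obtain ⟨h₁, H⟩ := H
  refine ⟨h₁, fun h hh r hr => ?_⟩
  obtain ⟨m, K, W, wt, e, hm, hK, he, hthr, Hu⟩ := H h hh r hr
  exact ⟨m, K, W, wt, e, hm, hK, he, hthr, fun u hu _ => Hu u hu⟩

/-- `AFit`-certificates give tables (`SymbJoin.AFit.exists_table`): the lower-set fitting conjecture implies the lower-set node. -/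
theorem universalJoinWideLower_of_afitLower (H : Stmt.afitLower) : Stmt.universalJoinWideLower := by
  obtain ⟨h₁, H⟩ := H
  refine ⟨h₁, fun h hh r hr => ?_⟩
  obtain ⟨m, K, W, wt, e, hm, hK, he, hthr, Hu⟩ := H h hh r hr
  exact ⟨m, K, W, wt, e, hm, hK, he, hthr, fun u hu hl => (Hu u hu hl).exists_table⟩

/-- One design for all lower `u` of size `r` serves in particular both members of a lower pair. -/
theorem pairJoinWideLower_of_universalJoinWideLower (H : Stmt.universalJoinWideLower) : Stmt.pairJoinWideLower := by
  obtain ⟨h₁, H⟩ := H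
  refine ⟨h₁, fun h hh r u w hu hw hlu hlw => ?_⟩
  have hr : r ≤ 2 ^ h := by
    have := Fintype.card_le_of_injective u hu
    rwa [Fintype.card_fin, Fintype.card_finset, Fintype.card_fin] at this
  obtain ⟨m, K, W, wt, e, hm, hK, he, hthr, Hu⟩ := H h hh r hr
  exact ⟨m, K, W, wt, e, hm, hK, he, hthr, Hu u hu hlu, Hu w hw hlw⟩

/-! ## Compositions with the crux (kernel-checked; `b = 12`) -/

/-- **The crux from the pair node.** Wide join door (`HiddenStatesLine.stub_joinDoorWide`, p569457: `b = 8` for `h ≥ 3`)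
on lower pairs, then the lower-set reduction (`DownCompression.partitionMinorsHitByVP_of_lowerSets`, p542445: `b + 4`). -/
theorem partitionMinorsHitByVP_of_pairJoinWideLower (H : Stmt.pairJoinWideLower) :
    Summit.ValiantsHypothesis.ValiantsHypothesis.Theses.BarrierLever.PartitionMinorsHitByVP := by
  obtain ⟨h₁, H⟩ := H
  refine DownCompression.partitionMinorsHitByVP_of_lowerSets ⟨8, max h₁ 3, fun h hh r u w hu hw hlu hlw => ?_⟩
  have hh₁ : h₁ ≤ h := le_trans (le_max_left _ _) hh
  have hh3 : 3 ≤ h := le_trans (le_max_right _ _) hh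
  obtain ⟨m, K, W, wt, e, hm, hK, he, hthr, ⟨tx, hx⟩, ⟨ty, hy⟩⟩ := H h hh₁ r u w hu hw hlu hlw
  exact HiddenStatesLine.stub_joinDoorWide h m K r hh3 hm hK u w e he W wt hthr tx ty hx hy

/-- **The crux from the lower-set node.** -/
theorem partitionMinorsHitByVP_of_universalJoinWideLower (H : Stmt.universalJoinWideLower) :
    Summit.ValiantsHypothesis.ValiantsHypothesis.Theses.BarrierLever.PartitionMinorsHitByVP :=
  partitionMinorsHitByVP_of_pairJoinWideLower (pairJoinWideLower_of_universalJoinWideLower H)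

/-- **The crux from the lower-set combinatorial fitting conjecture.** -/
theorem partitionMinorsHitByVP_of_afitLower (H : Stmt.afitLower) :
    Summit.ValiantsHypothesis.ValiantsHypothesis.Theses.BarrierLever.PartitionMinorsHitByVP :=
  partitionMinorsHitByVP_of_universalJoinWideLower (universalJoinWideLower_of_afitLower H)

end LowerNode

end

end Summit.ValiantsHypothesis.ValiantsHypothesis.Theorems.BarrierLever.HiddenStates
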